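import Summits.KontsevichZagierPeriods.KontsevichZagierPeriods.Theses.HurwitzMicroSectors
import Summits.KontsevichZagierPeriods.KontsevichZagierPeriods.Theorems.HurwitzMicroSectorsNormalFormPrinciplePiBoxTransfer
import Summits.KontsevichZagierPeriods.KontsevichZagierPeriods.Theorems.HurwitzMicroSectorsNormalFormPrincipleVariants2349

/-! TTRL-lite variant V2351 of stmt-KontsevichZagierPeriods-3869

Variant V2351 = `stub_boxRigidity` (BoxRigidity: two box-rational representations — domain the open
unit box, integrand `p/q` over `ℚ` — with equal values are KZ-equivalent) under the joint small-case move
`fix_nat:m'=3; bound_nat:m≤3`. Verdict of the attempt seat: **open** — this file is the exact-strength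
certificate, not a proof of the variant. V2351 is LOGICALLY EQUIVALENT to the sibling V2349
(`fix_nat:m'=3; bound_nat:m≤2`, file `…Variants2349`): both are BoxVanishing in dimension `3` — every
box-rational representation on `(0,1)³` of value `0` is a relation
(`stub_boxRigidity_var2351_iff_var2349`, `stub_boxRigidity_var2351_iff_boxVanishing_three`), hence also
to V2239 and V2350 and to BoxRigidity with `m, m' ≤ 3` (which side carries which bound `≤ 3`/`≤ 2` is
idle once `max = 3`). That is Conjecture 1 of Kontsevich–Zagier for rational integrands on the boxes
`(0,1)^{≤ 3}` (pairs `[1/(1−xyz)]` vs `[a + b/(1−xy)]`: the case split `ζ(3) ∈ ℚ + ℚπ²`; `[1/(1+x²y²)]`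
vs `[q]`: `G = q`), which no argument in the tree or in print proves; and
`KontsevichZagierPeriods → V2351` (`stub_boxRigidity_var2351_of_statement`), so a refutation would refute
the Summit — the only invariant of `KZ.relations` available is `eval`. The proved two-sided instance is
`m, m' ≤ 1` (`boxRigidity_of_le_one`, Baker).
Source: M. Kontsevich, D. Zagier, *Periods* (2001), §1.2 Conjecture 1. Pure proof file, no definitions. -/

-- `Summit.<Summit>.<Problem>` is the tree's mandated summit-side namespace (CONVENTIONS §2); for this
-- single-conjunct summit the two coincide, so the duplicate is deliberate.
set_option linter.dupNamespace false

noncomputable section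

namespace Summit.KontsevichZagierPeriods.KontsevichZagierPeriods.Theorems

open MeasureTheory Set
open Literature.NumberTheory.Transcendental Literature.NumberTheory.Transcendental.KZ
open Summit.KontsevichZagierPeriods.KontsevichZagierPeriods.Theses.HurwitzMicroSectors
open Summit.KontsevichZagierPeriods.HurwitzMicroSectors.NormalFormPrinciple.PiBox

/-- **V2351 ⟺ V2349**: `m ≤ 3` versus `m ≤ 2` against the frozen `3`-box is idle — V2349 is already
BoxRigidity with both dimensions `≤ 3` (`stub_boxRigidity_var2349_iff_boxRigidityLe_three`).
[cite: KontsevichZagier2001, §1.2 Conjecture 1] -/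
theorem stub_boxRigidity_var2351_iff_var2349 :
    (∀ (m : ℕ) (N : IntegralRep m) (N' : IntegralRep 3), m ≤ 3 → N.domain = {x | ∀ i, x i ∈ Set.Ioo (0:ℝ) 1} → N.IsRational → N'.domain = {x | ∀ i, x i ∈ Set.Ioo (0:ℝ) 1} → N'.IsRational → N.value = N'.value → Equivalent N N') ↔
    (∀ (m : ℕ) (N : IntegralRep m) (N' : IntegralRep 3), m ≤ 2 → N.domain = {x | ∀ i, x i ∈ Set.Ioo (0:ℝ) 1} → N.IsRational → N'.domain = {x | ∀ i, x i ∈ Set.Ioo (0:ℝ) 1} → N'.IsRational → N.value = N'.value → Equivalent N N') :=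
  ⟨fun h m N N' hm => h m N N' (hm.trans (by norm_num)),
    fun h m N N' hm => (stub_boxRigidity_var2349_iff_boxRigidityLe_three.1 h) m 3 N N' hm le_rfl⟩

/-- **V2351 ⟺ BoxVanishing in dimension `3`** (the honest strength of the variant: Conjecture 1 for all
box-rational periods of dimension `3`). [cite: KontsevichZagier2001, §1.2 Conjecture 1] -/
theorem stub_boxRigidity_var2351_iff_boxVanishing_three :
    (∀ (m : ℕ) (N : IntegralRep m) (N' : IntegralRep 3), m ≤ 3 → N.domain = {x | ∀ i, x i ∈ Set.Ioo (0:ℝ) 1} → N.IsRational → N'.domain = {x | ∀ i, x i ∈ Set.Ioo (0:ℝ) 1} → N'.IsRational → N.value = N'.value → Equivalent N N') ↔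
    (∀ (M : IntegralRep 3), M.domain = {x | ∀ i, x i ∈ Set.Ioo (0:ℝ) 1} → M.IsRational →
      M.value = 0 → of M ∈ relations) :=
  stub_boxRigidity_var2351_iff_var2349.trans stub_boxRigidity_var2349_iff_boxVanishing_three

/-- **V2351 ⟺ BoxRigidity with both dimensions `≤ 3`.** [cite: KontsevichZagier2001, §1.2 Conjecture 1] -/
theorem stub_boxRigidity_var2351_iff_boxRigidityLe_three :
    (∀ (m : ℕ) (N : IntegralRep m) (N' : IntegralRep 3), m ≤ 3 → N.domain = {x | ∀ i, x i ∈ Set.Ioo (0:ℝ) 1} → N.IsRational → N'.domain = {x | ∀ i, x i ∈ Set.Ioo (0:ℝ) 1} → N'.IsRational → N.value = N'.value → Equivalent N N') ↔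
    (∀ (m m' : ℕ) (N : IntegralRep m) (N' : IntegralRep m'), m ≤ 3 → m' ≤ 3 →
      N.domain = {x | ∀ i, x i ∈ Set.Ioo (0:ℝ) 1} → N.IsRational →
      N'.domain = {x | ∀ i, x i ∈ Set.Ioo (0:ℝ) 1} → N'.IsRational →
      N.value = N'.value → Equivalent N N') :=
  stub_boxRigidity_var2351_iff_var2349.trans stub_boxRigidity_var2349_iff_boxRigidityLe_three

/-- **The parent leaf ⇒ V2351** (specialisation `m' := 3`; the bound `m ≤ 3` is unused).
[cite: KontsevichZagier2001, §1.2 Conjecture 1] -/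
theorem stub_boxRigidity_var2351_of_parent
    (h : ∀ (m m' : ℕ) (N : IntegralRep m) (N' : IntegralRep m'), N.domain = {x | ∀ i, x i ∈ Set.Ioo (0:ℝ) 1} → N.IsRational → N'.domain = {x | ∀ i, x i ∈ Set.Ioo (0:ℝ) 1} → N'.IsRational → N.value = N'.value → Equivalent N N') :
    ∀ (m : ℕ) (N : IntegralRep m) (N' : IntegralRep 3), m ≤ 3 → N.domain = {x | ∀ i, x i ∈ Set.Ioo (0:ℝ) 1} → N.IsRational → N'.domain = {x | ∀ i, x i ∈ Set.Ioo (0:ℝ) 1} → N'.IsRational → N.value = N'.value → Equivalent N N' :=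
  fun m N N' _ => h m 3 N N'

/-- **`KontsevichZagierPeriods ⇒ V2351`**: the variant is a special case of Conjecture 1 for the tree's
calculus — a refutation of the variant would refute the Summit. [cite: KontsevichZagier2001, §1.2 Conjecture 1] -/
theorem stub_boxRigidity_var2351_of_statement (h : _root_.KontsevichZagierPeriods) :
    ∀ (m : ℕ) (N : IntegralRep m) (N' : IntegralRep 3), m ≤ 3 → N.domain = {x | ∀ i, x i ∈ Set.Ioo (0:ℝ) 1} → N.IsRational → N'.domain = {x | ∀ i, x i ∈ Set.Ioo (0:ℝ) 1} → N'.IsRational → N.value = N'.value → Equivalent N N' :=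
  stub_boxRigidity_var2351_of_parent (leaves_of_statement h).1

/-- **V2351 ⇒ Conjecture 1 on the level-`4` weight-`2` box sector, unconditionally** — the conclusion of
`CatalanSectorTwoFour` (stmt-KontsevichZagierPeriods-3877) WITHOUT its open hypothesis
`LinearIndependent ℚ ![1, π², G]`; for `[1/(1 + x²y²)]` (value `G`) against a rational constant `[q]` the
case split is `G = q`. [cite: KontsevichZagier2001, §1.2 Conjecture 1] -/
theorem sectorTwoFour_of_stub_boxRigidity_var2351
    (h : ∀ (m : ℕ) (N : IntegralRep m) (N' : IntegralRep 3), m ≤ 3 → N.domain = {x | ∀ i, x i ∈ Set.Ioo (0:ℝ) 1} → N.IsRational → N'.domain = {x | ∀ i, x i ∈ Set.Ioo (0:ℝ) 1} → N'.IsRational → N.value = N'.value → Equivalent N N') :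
    ∀ (r r' : IntegralRep 2) (P P' : Polynomial ℚ), r.domain = {x | ∀ i, x i ∈ Set.Ioo (0:ℝ) 1} → r'.domain = {x | ∀ i, x i ∈ Set.Ioo (0:ℝ) 1} → Set.EqOn r.integrand (fun x => Polynomial.aeval (x 0 * x 1) P / (1 - (x 0 * x 1) ^ 4)) r.domain → Set.EqOn r'.integrand (fun x => Polynomial.aeval (x 0 * x 1) P' / (1 - (x 0 * x 1) ^ 4)) r'.domain → r.value = r'.value → Equivalent r r' :=
  sectorTwoFour_of_stub_boxRigidity_var2349 (stub_boxRigidity_var2351_iff_var2349.1 h)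

end Summit.KontsevichZagierPeriods.KontsevichZagierPeriods.Theorems
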